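import Mathlib
import HarnessLib
import HarnessLib.Audit
import Summits.AtomisticToContinuum.Statement
import Literature.Geometry.DiscreteGeometry.KissingPatterns
import Literature.Geometry.DiscreteGeometry.FejesTothKissingTwelve
import Literature.MathematicalPhysics.StatisticalMechanics.HaggStacking
import Literature.MathematicalPhysics.StatisticalMechanics.BarlowStacking
import Literature.MathematicalPhysics.StatisticalMechanics.BarlowStackingEnergy

/-!
Route: CornerKeplerStability

CLOSED (retired) 2026-08-15T13:41:26Z by operator:999:1257524 — reason: not-a-thesis: assembly does not conclude the sub-problem Statement — note: D-0027 §2.1 audit (human 2026-08-15: routes that do not decide the summit are removed): the assembly concludes `CornerHcpOrder`, not the sub-problem statement; a NEW conforming route may be opened from the same idea (generated `closes : … → _root_.Crystallization`).. The file is kept as the record of this route; refuted decls are indexed as negative knowledge (`ledger negatives`).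

# Route CornerKeplerStability — Kepler's equality case is a crystallization theorem at the
density-decided corner of the Mie plane (hard core, tail −r⁻ᵐ/m, m ↓ 3)

RUNG ROUTE realising card kepler-stability-edge-of-summability (spine; absorbs the retired
kepler-measure-rigidity-density-priced-frustration, kepler-exact-penalty-critical-tail and the
closure card hales-thm-1-7-closes-kepler-stability). It suffices to show X = CornerHcpOrder: at the
corner (n, m) → (∞, 3⁺) of the Mie plane — hard core at distance 1 (finite wall M ≥ M₀(m)) plus the
completely monotone attraction −r⁻ᵐ/m at the edge of summability — ground states x^N of the pair
energy are locally HCP in the ITERATED limit: for every window R, tolerance δ and fraction η there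
is m₀ > 3 such that for all m ∈ (3, m₀) (and M ≥ M₀(m)), for all large N, all but ηN particles have
their R-neighbourhood two-way δ-matched by a rigid image of the ideal hcp stacking (spacing 1).
Mechanism: (E) STABLE KEPLER — Hales–Ferguson's equality case (Hales1998 Thm 1.6/1.7: the score σ
attains 8 pt exactly at fcc/hcp kissing stars, U(D) = centres within 2t₀, t₀ = 1.255) + compactness
of the space of decomposition stars + the affine identity of Lemma 1.5 and the five-line Lemma 1.2
give a LINEAR one-centre counting bound #(V ∩ B_r) ≤ √2·(4π/3)r³ − κ(ε)·#(ε-non-Barlow centres in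
B_r) + C r² with UNIFORM C (crux StableKeplerCounting); (A) EDGE OF SUMMABILITY — by parts, e =
−½∫₁^∞ r^(−m−1) K̄(r) dr, so a counting deficit at scale r costs dr/r^(m−2) → dr/r and the far field
prices every non-Barlow fraction at κ f/(m−3) against an m-uniform O(1) near-field budget: limsup_N
f ≤ Φ(m) → 0 (crux CornerBarlowOrder, via Hales 2012 kissing-twelve rigidity by compactness); (S)
the CM tail selects hcp among all Barlow stackings uniformly down to the edge (J₂ < 0 by
Poisson–Bessel positivity, Hägg domination; crux CornerStackingDomination) and stacking faults are
unfunded in the limit (glue). The assembly ends in the route's Target, NOT in `Crystallization`: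
Lennard-Jones (12,6) sits strictly inside the Mie plane where neither corner inequality suffices
(weight r⁻⁷dr is near-field dominated; Ferguson's 3×10⁻⁴ pt deficit floor makes κ useless at m = 6).
Summit-facing deliverables are the shared engine items (StableKeplerCounting, UniformKeplerCounting,
SoftFejesTothHales, CornerStackingDomination, HaggDominationAllRanges = stmt-0737) consumed by LJ
tail/stacking accounting (cards bernstein-split-kepler-tail, theta-universality-packings,
hull-exactification-cascade; routes CrystalKissingRigidity K3, RefuteCrystalPeriodicMin).
Lean: `∀ R δ η : ℝ, 0 < R → 0 < δ → 0 < η → ∃ m₀ : ℝ, 3 < m₀ ∧ ∀ m : ℝ, 3 < m → m < m₀ → ∃ M₀ : ℝ, ∀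
M : ℝ, M₀ ≤ M → ∀ x : (N : ℕ) → (Fin N → EuclideanSpace ℝ (Fin 3)), (∀ N,
Literature.MathematicalPhysics.StatisticalMechanics.IsGroundState (fun r : ℝ => if r < 1 then M else
-(r ^ (-m)) / m) (x N)) → ∀ᶠ N : ℕ in Filter.atTop, (Nat.card {i : Fin N // ¬ ∃ g : EuclideanSpace ℝ
(Fin 3) ≃ᵢ EuclideanSpace ℝ (Fin 3), (∀ j : Fin N, dist (x N j) (x N i) ≤ R → ∃ z ∈ g ''
Literature.MathematicalPhysics.StatisticalMechanics.hcpStacking 1 (Real.sqrt (2 / 3)), dist (x N j)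
z ≤ δ) ∧ (∀ z ∈ g '' Literature.MathematicalPhysics.StatisticalMechanics.hcpStacking 1 (Real.sqrt (2
/ 3)), dist z (x N i) ≤ R → ∃ j : Fin N, dist (x N j) z ≤ δ)} : ℝ) ≤ η * N`

## Assembly
Pure logic over the items plus the tree's named fact
`Literature.Geometry.DiscreteGeometry.FejesTothKissingTwelve` (Hales 2012 Thm 1 + DSP §1.3; in tree
it follows from the two computer-assisted facts flyspeck_L12 and Hales2012_contactGraphTame,
everything else proved): SoftFejesTothHales applied to the named fact gives the soft local theorem;
CornerGlue turns StableKeplerCounting + it + FiniteWallHardCore into CornerBarlowOrder;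
CornerFaultsGlue turns CornerBarlowOrder + CornerStackingDomination + HaggDominationAllRanges into
the Target. Checked sorry-free in the planner's Sketch.lean (`assembly_provable`). The chain ends in
the route's Target CornerHcpOrder (a rung at the density-decided corner), deliberately not in
Summit.AtomisticToContinuum.Crystallization.

Rationale: WHY THIS LINE. Every 3-D crystallization attempt dies on frustration: locally, non-Barlow order is
denser and better bound (DLP: Z_max(R) > Z_Bar(R); IcosahedralClusters), and the only global theorem
saying it cannot EXTEND is Kepler's — used so far only as a bound (Hales_kepler in
TetrahedralFrustration.lean; tail bounds in the kissing routes), never through its EQUALITY CASE,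
which Hales–Ferguson proved together with the theorem (Hales1998 = arXiv:math/9811078, Thm 1.7,
Lemma 1.8; BoroczkyRadchenkoRamos2024 is the d = 8, 24 analogue and the only printed "stability of
sphere packing"). At the edge of summability the energy IS the density integrated over scales with
weight dr/r (the poppy-seed-bagel regime of BorodachovHardinSaff2019, here at zero pressure with a
hard core), so Kepler stability alone converts ground-state energy into microscopic structure —
exactly the step KubinPonsiglione2021 (hard spheres + Riesz tails, arXiv:2004.06820 p. 3:
"crystallization is replaced by the related but different concept of optimal packing") do not take.
Imported areas: discrete geometry of sphere packings (Hales–Ferguson local optimality and its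
compact configuration space; Hales2012 kissing-twelve rigidity, in tree down to two
computer-assisted named facts), potential theory at the hypersingular edge (Riesz s ↓ d
asymptotics), 1-D long-range lattice gases (Hägg domination, stmt-0737) and Poisson–Bessel
positivity for completely monotone layer sums (stacking selection). What no prior route does:
CrystalKissingRigidity/CrystalLocalRigidity need a ROBUST local theorem at positive slack (crux
0758, open; FlexibleKissingArrangements) and BenjaminiSchrammGroundStates needs LJ-specific
structure of stationary minimisers; here the only rigidity used is the EXACT (ε = 0) kissing-twelve
theorem, reached by compactness because the far field drives the defect fraction to zero first.
Negatives index: empty at filing.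

RANKED CRUXES. #0 CornerHcpOrder (target) — X (card T1 = A1 + A2): for all R, δ, η > 0 there is m₀ >
3 such that for every m ∈ (3, m₀) there is a wall height M₀ with: for every M ≥ M₀ and every
sequence of ground states x^N of V_{M,m}(r) = M (r < 1), −r⁻ᵐ/m (r ≥ 1) in ℝ³, eventually in N at
most ηN particles i fail to have x^N ∩ B̄_R(x_i) two-way δ-matched with g(hcpStacking 1 √(2/3)) for
some isometry g — iterated limit lim_{m↓3} limsup_N (non-hcp fraction) = 0. (why it might fail:
Fixed-m exactness is NOT claimed (one-centre counting leaves O(r²) slack; defects below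
~(m−3)^{1/(m−3)} are invisible); the iterated limit fails only if stacking faults stay funded as m ↓
3 (registry scale e^{−4π√2/3·k} vs defect budget Φ(m) → 0) or J₂(m) ≥ 0 near 3.) [Hales1998,
Hales2012, KubinPonsiglione2021, BeterminSamajTravenec2022, PartayOrtnerCsanyi2017]
#2 StableKeplerCounting (crux) — STABLE KEPLER, one-centre counting form with uniform constants
(card (E)/S2, decomposition-free): for every ε > 0 there are κ > 0 and C such that for every
1-separated V ⊂ ℝ³, every p and every r ≥ 1, #(V ∩ B̄(p,r)) ≤ (4√2π/3) r³ − κ·#{v ∈ V ∩ B̄(p,r) :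
the punctured neighbour set of v within 1.255 (= 2t₀ in diameter units), recentred, is not
ε-ShellCloseTo the fcc or hcp kissing pattern} + C r². Route to a proof: Hales1998 Thm 1.6 (max σ =
8 pt on the compact space X of decomposition stars, σ continuous) + Thm 1.7 (equality ⇒ U(D) is the
fcc/hcp kissing arrangement) ⇒ κ(ε) := 8 pt − max_{Bad_ε} σ > 0; Lemma 1.5's affine identity Vol
Ω(v) + a(v) = √32 + (8 pt − σ)/(4δ_oct) kept as a surplus in the five-line Lemma 1.2 (saturated
packings, Voronoi cells in balls of radius 2, negligibility Σ a ≤ C₁r²) gives the linear bound for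
saturated packings; de-saturate (added centres are counted by the density term and explain at most
C₀ newly-bad neighbours each, κC₀ ≤ 1). Expected to be vendored as a Literature named fact
HalesFerguson_scoreEquality (cite item filed) and then restated `(h : …) →`. [difficulty: XL] (why
it might fail: Uniformity of C over ALL packings rests on a universal negligibility constant C₁ of
[formulation] DCG 36 (2006) (tree's Hales_kepler is vendored non-uniform: ∃c after ∀V); closedness
of Bad_ε in X at the truncation radius 2t₀; DCG 44 (2010) revision errata for Thm 1.7.) [Hales1998,
HalesDSP2012, HalesEtAl2015, Lagarias2002LocalDensity, BoroczkyRadchenkoRamos2024, Hales1997]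
#3 CornerBarlowOrder (crux) — BARLOW LOCAL ORDER AT THE CORNER (card A1, finite-N form, no point
processes): as CornerHcpOrder but with "g(barlowStacking 1 √(2/3) s) for some Hägg sequence s and
isometry g" in place of hcp — lim_{m↓3} limsup_N (fraction of particles whose R-neighbourhood is not
δ-close to a rigid image of SOME close-packed stacking) = 0. Proof plan (= CornerGlue): E(N)/N =
−½∫₁^∞ r^(−m−1) K̄(r) dr with K̄ the mean neighbour count; D_i(r) := K_max(r) − K_i(r) ≥ 0;
StableKeplerCounting at p = x_i summed over i and symmetrised gives D̄(r) ≥ (κ f_ε K_max(r) − C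
r²)/(1+κ); the hcp-ball trial state and UNIFORM Kepler (K_max − K_hcp ≤ C r²) give ½∫ r^(−m−1) D̄ ≤
C/(m−2) + o_N(1); hence limsup_N f_ε ≤ Φ_ε(m) = O((m−3)^{1/(m−2)}/κ(ε)) → 0; particles with an ε-bad
particle within R′ are ≤ K_max(R′)·(bad count); SoftFejesTothHales(R, δ) converts R′-interior
ε-goodness into the Barlow R-fragment matching. [deps: StableKeplerCounting] [difficulty: L] (why it
might fail: Needs StableKeplerCounting with UNIFORM C (else the far-field gain κf/(m−3) drowns in
C/(m−3)); the trial-state boundary term C N^{(3−m)/3}/(m−3) forces N → ∞ before m ↓ 3 — the iterated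
order is essential and the only one claimed.) [Hales1998, Hales2012, KubinPonsiglione2021,
BorodachovHardinSaff2019, BlancLewin2015]
#4 CornerStackingDomination (crux) — THE CM TAIL SELECTS HCP UNIFORMLY DOWN TO THE EDGE (card A2):
for every m ∈ (3, 4], with J_k(m) := barlowCoupling (r ↦ −r⁻ᵐ/m) 1 √(2/3) k
(aligned-minus-non-aligned interaction of a site with the layer k levels away, ideal geometry):
J₂(m) < 0, Σ k|J_k| < ∞ and J₂ + Σ_{k≥3}(k−1)|J_k| ≤ 0 — exactly the hypotheses of
HaggDominationAllRanges (stmt-0737), whence the alternating (hcp) word minimises the stacking energy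
window-wise. Proof plan: Poisson summation on the triangular layer lattice; for the completely
monotone φ(u) = u^(−m/2) the 2-D transform of x ↦ φ(|x|²+z²) is a positive Gaussian/Bessel mixture,
so J_k = −(1/A)Σ_{G≠0} φ̂_{kh}(G)(1 − cos 2πG·w) < 0 for all k ≥ 1, m > 2, and |J_{k+1}/J_k| ≈
e^{−2π|G₁|h} = e^{−4π√2/3} ≈ 2.7×10⁻³ gives domination with four orders of margin; alternatively
certified interval numerics with a Bessel tail bound. [difficulty: M] (why it might fail: Low risk:
sign is Poisson–Bessel positivity for a CM tail and BST2022 Fig. 3 has ζ_hcp − ζ_fcc > 0 for all s >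
3/2; fails only through tsum junk (layer sums need m > 2, fine) or if Bessel prefactors grew fast
enough in k to eat the e^{−5.92k} margin.) [BeterminSamajTravenec2022, BurrowsEtAl2020,
KiharaKoba1952, PartayOrtnerCsanyi2017, BurrowsCooperSchwerdtfeger2021]
#9 SoftFejesTothHales (support) — SOFT FEJES TÓTH–HALES BY COMPACTNESS (qualitative, rate-free;
known modulo the tree's named fact): FejesTothKissingTwelve → for all R, δ > 0 there are ε > 0, R′
such that for every 1-separated V ∋ p all of whose points within R′ of p have their punctured
1.255-neighbourhood ε-ShellCloseTo the fcc or hcp pattern, V ∩ B̄(p,R) is two-way δ-matched with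
g(barlowStacking 1 √(2/3) s) for some Hägg s and isometry g. Proof: contradiction + local Hausdorff
compactness of 1-separated sets; the limit set (scaled by 2) is a unit-ball packing with kissing
number twelve (pattern shells exclude further centres below ≈1.41), so FejesTothKissingTwelve (+
HalesDSP_layerPackings_holds, in tree) makes it a Barlow stacking; rescale barlowStacking 2
(2√(2/3)) s = 2•barlowStacking 1 √(2/3) s. [difficulty: M] [Hales2012, HalesDSP2012]
#9 FiniteWallHardCore (support) — FINITE WALL = HARD CORE: for every m > 3 there is M₀ such that for
all M ≥ M₀ and all N, ground states of V_{M,m} exist and have all interparticle distances ≥ 1.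
Proof: E(N) ≤ E(N−1) − 1/m (add a touching particle beyond the x-extreme one), so every site energy
of a ground state is ≤ 0; cubes of side ½ hold ≤ 1 + n* particles (n* = max number of sub-unit
neighbours), so a particle with n* close neighbours has site energy ≥ M n* − (1+n*)C_m, forcing n* =
0 once M > 2C_m (C_m = Σ_cubes dist^(−m)/m < ∞ for m > 3); existence by lower semicontinuity of V
(V(1) = −1/m ≤ M) + strict binding/translation compactness as in
LennardJonesGroundStatesExist_holds. [difficulty: M] [BlancLewin2015, KubinPonsiglione2021]
#9 UniformKeplerCounting (support) — UNIFORM KEPLER COUNTING BOUND (known; Hales1998 Lemma 1.2 /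
HalesDSP2012 Lemma 6.13 + Thm 6.9 with the constant made uniform over packings, de-saturated): there
is C with #(V ∩ B̄(p,r)) ≤ (4√2π/3) r³ + C r² for every 1-separated V, p, r ≥ 1. Implied by
StableKeplerCounting (uniformKepler_of_stable in the planner's Sketch); filed separately because the
glue needs it at every scale and LJ tail-accounting routes want it as is. [difficulty: L]
[Hales1998, HalesDSP2012, HalesEtAl2015]
#9 HaggDominationAllRanges (support) — HÄGG DOMINATION, all ranges, arbitrary Hägg word, finite
volume with O(1) boundary term — verbatim the shared item stmt-AtomisticToContinuum-0737 (Peierls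
count): n·Σ_{k even} J_k ≤ H_n(J,s) + Σ k|J_k| under Σ k|J_k| < ∞ and J₂ + Σ_{k≥3}(k−1)|J_k| ≤ 0.
[difficulty: provable-now] [PartayOrtnerCsanyi2017, BlancLewin2015]
#9 CornerGlue (support) — THE EDGE-OF-SUMMABILITY BOOKKEEPING (glue of the foreseen split of
CornerBarlowOrder): StableKeplerCounting → (conclusion of SoftFejesTothHales) → (conclusion of
FiniteWallHardCore) → CornerBarlowOrder, by the by-parts identity, the deficit functional D̄, the
hcp-ball trial state and the R′-interior-good counting described under CornerBarlowOrder; constants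
m-uniform, limits in the order N → ∞ then m ↓ 3. [difficulty: L] [Hales1998, KubinPonsiglione2021,
BlancLewin2015]
#9 CornerFaultsGlue (support) — STACKING FAULTS ARE UNFUNDED AT THE CORNER (glue): CornerBarlowOrder
→ CornerStackingDomination → (stmt-0737) → CornerHcpOrder. In a configuration that is Barlow-ordered
off a fraction f → 0, the energy relative to the hcp trial splits into far field (≥ 0, Kepler),
defect near field (≤ G·f, G m-uniform), and layer-registry terms of the Barlow grains, which by
barlowSiteEnergy_eq / Hägg domination exceed the alternating word's by ≥ c_J·(fault density) −
O(grain-boundary density), c_J = |J₂| − Σ_{k≥3}(k−1)|J_k| > 0 m-uniform; a ground state has excess ≤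
o_N(1), so the fault density is ≤ (G f + o(1))/c_J → 0 and Barlow fragments upgrade to hcp fragments
(larger R′, same δ). [difficulty: L] [PartayOrtnerCsanyi2017, BeterminSamajTravenec2022, Hales2012]

TWO-LAYER PLAN. Foreseen split 1 (once UniformKeplerCounting or SoftFejesTothHales closes):
CornerBarlowOrder ⇐ StableKeplerCounting → SoftFejesTothHales-conclusion →
FiniteWallHardCore-conclusion → CornerBarlowOrder, glue = CornerGlue (filed now as support so the
bookkeeping can be proved early against the crux as hypothesis). Foreseen split 2 (once
CornerBarlowOrder closes): CornerHcpOrder ⇐ CornerBarlowOrder → CornerStackingDomination →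
CornerHcpOrder, glue = CornerFaultsGlue. Foreseen split 3 (if a grounder vendors Hales–Ferguson):
StableKeplerCounting ⇐ HalesFergusonScoreEquality (named fact: Thm 1.6/1.7 + compact X, continuous
σ, uniform negligibility) → SaturatedSurplusBound (Lemma 1.2 with surplus) → StableKeplerCounting
(de-saturation glue). Nothing here is filed now.

KILL CRITERIA. StableKeplerCounting refuted AS STATED (a 1-separated family whose counting excess
over √2·vol is not O(r²) uniformly, or whose ε-bad fraction is not priced linearly) ⇒ restate with
the constant structure the refutation dictates (non-uniform C kills CornerGlue: then close
`refuted:StableKeplerCounting`, the line is dead because κf/(m−3) must beat C/(m−3)).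
CornerStackingDomination refuted (J₂(m) ≥ 0 or domination fails for some m ∈ (3,4]) ⇒ pivot: Target
weakens to CornerBarlowOrder plus whatever word the certified couplings select (drop
CornerFaultsGlue, restate Target); the engine survives. CornerBarlowOrder refuted with
StableKeplerCounting standing ⇒ the bookkeeping is wrong (trial state / order of limits) — close
`refuted:CornerBarlowOrder`. Mooted-by: nothing on the summit moots a rung; conversely a proof here
does not close Crystallization and is not claimed to.

NOT DECOMPOSED YET. The Hales–Ferguson vendoring behind StableKeplerCounting (decomposition stars,
the score σ, compactness of X, closedness of Bad_ε, the negligibility constant) — one crux now,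
split 3 above only after a grounder reports what [formulation] prints; the de-saturation lemma; the
by-parts identity and D̄-algebra as separate lemmas (they ride with CornerGlue via --supports);
grain/registry bookkeeping inside CornerFaultsGlue; the periodic-minimiser statement at the corner
(hcp is the unique periodic minimiser of e_m among hard-core periodic configurations for m near 3 —
true in the same iterated sense, not needed for X); any fixed-m exact statement (needs an exact
far-field device, cf. card interfacial-tails-and-the-delta-n-leak — out of scope); effective κ(ε) by
mining the 1998 score (card P4/N5: mine σ, not Flyspeck's τ) — out of scope.

CHEAPEST FALSIFIER. (1) For CornerStackingDomination: evaluate J₂(m), J₃(m) for m ∈ {3.01, 3.1, 3.5,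
4} by the Poisson–Bessel series (ten reciprocal shells, kit py, minutes) — sign of J₂ and the ratio
Σ_{k≥3}(k−1)|J_k|/|J₂| (predicted ≈ 5×10⁻³); consistent evidence already in print:
BeterminSamajTravenec2022 Fig. 3 (ζ_A3 − ζ_D3 > 0 for all s > 3/2, smooth through s = 3) and the
fcc/hcp lattice-sum tables of BurrowsEtAl2020 (paywalled here, acq-00780). (2) For
StableKeplerCounting: a one-hour reading of Hales–Ferguson, "A formulation of the Kepler
conjecture", DCG 36 (2006) §§3–4: is the negligibility constant C₁ universal, and does the 2010
revision (DCG 44) leave Thm 1.7 and Ferguson's pentahedral-prism bound 7.9997 pt intact? (3) Junk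
audit done by hand: V = ∅ and finite clusters satisfy StableKeplerCounting trivially (C ≥ 13(1+κ));
hcp satisfies it with the O(r²) lattice-count error; hcp with vacancy density ρ forces κ ≤ 1/12; a
uniform dilation by 1+2ε forces κ(ε) ≲ 6√2 ε — all consistent with an ineffective compactness κ.

NUMBERS. t₀ = 1.255 (2t₀ = 2.51, Hales1998 p. 4); number density of ideal close packings at contact
distance 1: √2, so the main term is (4√2π/3) r³ ≈ 5.924 r³; π/√18 ≈ 0.74048; proved score deficit on
the pentahedral-prism (five-fold) stratum 8 pt − 7.9997 pt = 3×10⁻⁴ pt (Ferguson, SP V) — why κ is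
quantitatively useless at m = 6 and why only the corner is claimed; registry decay per layer
e^{−2π|G₁|h} = e^{−4π√2/3} ≈ 2.7×10⁻³ (|G₁| = 2/√3, h = √(2/3)); J₂(LJ 12-6) ≈ −7.3×10⁻⁵
(route-internal numerics of RefuteCrystalPeriodicMin, uncertified); ζ_hcp(s) − ζ_fcc(s) > 0 for all
s > 3/2 at equal density (BeterminSamajTravenec2022 Fig. 3, numerics); bcc relative density
0.68017/0.74048 = 0.9186 (priced out at the corner by (4π/3)(0.08·√2)R^{3−m}/(m−3)); far-field share
of the LJ (12,6) binding inside the first shell ≈ 75% (card margin-map-one-centre-traps) — the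
reason (12,6) is not at the corner. Items at open: 11.

DEFINITION REQUESTS. None: everything is typed inline over IsGroundState /
PeriodicConfiguration-free finite configurations, ShellCloseTo, fcc/hcpKissingPattern,
barlowStacking/hcpStacking, barlowCoupling, FejesTothKissingTwelve. Cite fact wanted (filed right
after open as a cite workitem): `HalesFerguson_scoreEquality` — Hales1998 (Ann. Math. 162) Thm 1.6 +
Thm 1.7 + Lemma 1.8, with the [formulation] facts "X compact, σ continuous, a(v) negligible with a
universal constant"; once it lands the planner restates StableKeplerCounting as
`HalesFerguson_scoreEquality → …` (split 3).

Novelty: Searches (2026-08-15): `lit search --source zbmath "Kepler conjecture stability"` (10, none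
relevant: celestial-mechanics Kepler), `--source zbmath "hard spheres Riesz attractive
crystallization"` (1: KubinPonsiglione2021), `--source crossref "quantitative stability sphere
packing"` (10: BoroczkyRadchenkoRamos2024 the only hit on point), `--source zbmath "poppy-seed bagel
theorem Riesz energy hypersingular"` (1: BorodachovHardinSaff2019), `--source crossref "hexagonal
close packed versus face centred cubic lattice sums Lennard-Jones exponent"` (10: BurrowsEtAl2020,
Burrows–Cooper–Schwerdtfeger PRE 107 (2023) 065302 — both paywalled, acq-00780/acq-01263), `--source
zbmath "Burrows Schwerdtfeger lattice sums close-packed"` (1); local searchd and galaxy (`lit galaxy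
search "stability of the Kepler conjecture" --star all`, `"lattice sums for cubic and hexagonal
close-packed" --star pdf`) unavailable all session (connection reset / queue saturated),
arXiv/OpenAlex/S2 HTTP 429; held texts READ: Hales1998 pp. 3–4 (Lemma 1.2, Remark 1.3 "compact
topological space X and a continuous function σ", Thm 1.6, Thm 1.7, t₀ = 1.255),
KubinPonsiglione2021 pp. 2–4, BeterminSamajTravenec2022 pp. 6, 8; plus the two refuter novelty
audits on the card (R8, refuter-12) and the audit retiring hales-thm-1-7-closes-kepler-stability as
known.
Nearest prior art found: Hales1998 (arXiv:math/9811078) Thm 1.7 — the equality case, never turned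
into a stability statement in print; BoroczkyRadchenkoRamos2024 (  [refs: 10.1515/crelle-2024-0002, math/9811078, 2004.06820, 1209.6043, 2107.14020, doi:10.1515/crelle-2024-0002, KubinPonsiglione2021, BoroczkyRadchenkoRamos2024, BorodachovHardinSaff2019, BurrowsEtAl2020, Hales1998, BeterminSamajTravenec2022, Hales2012]

Barriers (technique_class: kepler-stability, equality-case-compactness, mie-corner): - technique_class: kepler-stability, equality-case-compactness, mie-corner
- Literature.Barriers.AtomisticToContinuum.TetrahedralFrustration: APPLIES and is used, not fought —
pure Voronoi/simplex bounds are not sharp, so the engine is Hales–Ferguson's HYBRID score σ, whose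
isolated equality set (Thm 1.7) is exactly what compactness needs; the barrier's quantitative shadow
is the tiny κ on five-fold strata (3×10⁻⁴ pt), harmless at the corner where the lever is 1/(m−3).
- Literature.Barriers.AtomisticToContinuum.IcosahedralClusters: conceded in full — near-field
polytetrahedral/icosahedral gains enter only as the m-uniform O(1) budget C/(m−2) that the far field
outgrows; nothing is claimed at (12,6) or at finite N.
- Literature.Barriers.AtomisticToContinuum.FlexibleKissingArrangements: evaded — no single-shell or
positive-slack rigidity is used; ε-goodness is priced by Kepler stability and converted to structure
only through the EXACT kissing-twelve theorem via compactness (SoftFejesTothHales assumes goodness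
on a whole ball B_{R′} and concludes on B_R, rate-free).
- Literature.Barriers.AtomisticToContinuum.KissingTwelveDegeneracy: APPLIES at leading order (all
Barlow stackings tie in density and in contacts) — evaded at the next, m-uniform order by
CornerStackingDomination + Hägg domination (its evasion (ii): the tail beyond √(8/3) selects the
stacking), with faults unfunded because the defect budget vanishes first.
- Literature.Barriers.AtomisticToContinuum.ShortRangeStackin

Novelty grade: new-combination — ROUTE REVIEW (refuter, 2026-08-15) — route was CLOSED retired by the operator at 13:41Z during this review (D-0027 §2.1 not-a-thesis: Assembly concludes CornerHcpOrder, not Crystallization; same sweep as AdhesiveTailRung). Concur: the route's own text says the chain 'deliberately' ends at the corner (refuter refuter-rreview-route-CriticalPhenomena--7dc828c2-0, 2026-08-15T14:03:04Z; prior: arXiv:math/9811078 (Hales1998 Thm 1.6/1.7, Lemma 1.2/1.5: equality case of the score), arXiv:1209.6043 (Hales 2012 kissing-twelve rigidity; in tree FejesTothKissingTwelve), arXiv:2004.06820 (KubinPonsiglione2021: hard core + Riesz tail, optimal packing not crystallization), doi:10.1515/crelle-2024-0002 (Böröczky–Radchenko–Ramos: stability of sphere packing, d=8,24), BeterminSamajTravenec2022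 Fig. )

History (route lifecycle, newest last):
- 2026-08-15T13:41:26Z · CLOSED retired — not-a-thesis: assembly does not conclude the sub-problem Statement (operator:999:1257524)

sub-problem: Crystallization · status: closed(retired) · opened planner-plancard-AtomisticToContinuum-Crystal-986d6369-0 2026-08-15T11:42:12Z · rev 0 · ledger route-AtomisticToContinuum-CornerKeplerStability
GENERATED by the gate from the ledger (D-0016/17). Provers cite these decls: `theorem foo : Summit.AtomisticToContinuum.Crystallization.Theses.CornerKeplerStability.<Decl> := …` in Summits/AtomisticToContinuum/Crystallization/Theorems/<Name>.lean.
-/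

namespace Summit.AtomisticToContinuum.Crystallization.Theses.CornerKeplerStability

open scoped BigOperators Topology Manifold Classical MeasureTheory ProbabilityTheory Matrix InnerProductSpace ComplexConjugate ContinuousMap
open Filter Set Function TopologicalSpace MeasureTheory

attribute [summit_statement] _root_.Crystallization

/-- item stmt-AtomisticToContinuum-5713 · target · rank 0 · closed · moot by None · by planner
why it might fail: Fixed-m exactness is NOT claimed (one-centre counting leaves O(r²) slack; defects below ~(m−3)^{1/(m−3)} are invisible); the iterated limit fails only if stacking faults stay funded as m ↓ 3 (registry scale e^{−4π√2/3·k} vs defect budget Φ(m) → 0) or J₂(m) ≥ 0 near 3.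
sources: Hales1998, Hales2012, KubinPonsiglione2021, BeterminSamajTravenec2022, PartayOrtnerCsanyi2017
[target] X (card T1 = A1 + A2): for all R, δ, η > 0 there is m₀ > 3 such that for every m ∈ (3, m₀)
there is a wall height M₀ with: for every M ≥ M₀ and every sequence of ground states x^N of
V_{M,m}(r) = M (r < 1), −r⁻ᵐ/m (r ≥ 1) in ℝ³, eventually in N at most ηN particles i fail to have
x^N ∩ B̄_R(x_i) two-way δ-matched with g(hcpStacking 1 √(2/3)) for some isometry g — iterated limit
lim_{m↓3} limsup_N (non-hcp fraction) = 0. -/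
@[route_item "route-AtomisticToContinuum-CornerKeplerStability"]
def CornerHcpOrder : Prop :=
  ∀ R δ η : ℝ, 0 < R → 0 < δ → 0 < η → ∃ m₀ : ℝ, 3 < m₀ ∧ ∀ m : ℝ, 3 < m → m < m₀ → ∃ M₀ : ℝ, ∀ M : ℝ, M₀ ≤ M → ∀ x : (N : ℕ) → (Fin N → EuclideanSpace ℝ (Fin 3)), (∀ N, Literature.MathematicalPhysics.StatisticalMechanics.IsGroundState (fun r : ℝ => if r < 1 then M else -(r ^ (-m)) / m) (x N)) → ∀ᶠ N : ℕ in Filter.atTop, (Nat.card {i : Fin N // ¬ ∃ g : EuclideanSpace ℝ (Fin 3) ≃ᵢ EuclideanSpace ℝ (Fin 3), (∀ j : Fin N, dist (x N j) (x N i) ≤ R → ∃ z ∈ g '' Literature.MathematicalPhysics.StatisticalMechanics.hcpStacking 1 (Real.sqrt (2 / 3)), dist (x N j) z ≤ δ) ∧ (∀ z ∈ g '' Literature.MathematicalPhysics.StatisticalMechanics.hcpStacking 1 (Real.sqrt (2 / 3)), dist z (x N i) ≤ R → ∃ j : Fin N, dist (x N j) z ≤ δ)} : ℝ) ≤ η *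 N

/-- item stmt-AtomisticToContinuum-5714 · crux · rank 2 · closed · moot by None · by planner
why it might fail: Uniformity of C over ALL packings rests on a universal negligibility constant C₁ of [formulation] DCG 36 (2006) (tree's Hales_kepler is vendored non-uniform: ∃c after ∀V); closedness of Bad_ε in X at the truncation radius 2t₀; DCG 44 (2010) revision errata for Thm 1.7.
sources: Hales1998, HalesDSP2012, HalesEtAl2015, Lagarias2002LocalDensity, BoroczkyRadchenkoRamos2024, Hales1997
[crux] STABLE KEPLER, one-centre counting form with uniform constants (card (E)/S2,
decomposition-free): for every ε > 0 there are κ > 0 and C such that for every 1-separated V ⊂ ℝ³,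
every p and every r ≥ 1, #(V ∩ B̄(p,r)) ≤ (4√2π/3) r³ − κ·#{v ∈ V ∩ B̄(p,r) : the punctured
neighbour set of v within 1.255 (= 2t₀ in diameter units), recentred, is not ε-ShellCloseTo the fcc
or hcp kissing pattern} + C r². Route to a proof: Hales1998 Thm 1.6 (max σ = 8 pt on the compact
space X of decomposition stars, σ continuous) + Thm 1.7 (equality ⇒ U(D) is the fcc/hcp kissing
arrangement) ⇒ κ(ε) := 8 pt − max_{Bad_ε} σ > 0; Lemma 1.5's affine identity Vol Ω(v) + a(v) = √32 +
(8 pt − σ)/(4δ_oct) kept as a surplus in the five-line Lemma 1.2 (saturated packings, Voronoi cells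
in balls of radius 2, negligibility Σ a ≤ C₁r²) gives the linear bound for saturated packings;
de-saturate (added centres are counted by the density term and explain at most C₀ newly-bad
neighbours each, κC₀ ≤ 1). Expected to be vendored as a Literature named fact
HalesFerguson_scoreEquality (cite item filed) and then restated `(h : …) →`. [difficulty: XL] -/
@[route_item "route-AtomisticToContinuum-CornerKeplerStability"]
def StableKeplerCounting : Prop :=
  ∀ ε : ℝ, 0 < ε → ∃ κ C : ℝ, 0 < κ ∧ ∀ V : Set (EuclideanSpace ℝ (Fin 3)), (∀ v ∈ V, ∀ w ∈ V, v ≠ w → 1 ≤ dist v w) → ∀ (p : EuclideanSpace ℝ (Fin 3)) (r : ℝ), 1 ≤ r → (({v ∈ V | dist v p ≤ r}).ncard : ℝ) ≤ 4 * Real.sqrt 2 * Real.pi / 3 * r ^ 3 - κ * (({v ∈ V | dist v p ≤ r ∧ ¬ ∃ T : Finset (EuclideanSpace ℝ (Fin 3)), (↑T : Set (EuclideanSpace ℝ (Fin 3))) = (fun w => w - v) '' {w | w ∈ V ∧ w ≠ v ∧ dist w v ≤ 1.255} ∧ (Literature.Geometry.DiscreteGeometry.ShellCloseTo ε T Literature.Geometry.DiscreteGeometry.fccKissingPattern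 ∨ Literature.Geometry.DiscreteGeometry.ShellCloseTo ε T Literature.Geometry.DiscreteGeometry.hcpKissingPattern)}).ncard : ℝ) + C * r ^ 2

/-- item stmt-AtomisticToContinuum-5715 · crux · rank 3 · closed · moot by None · by planner
why it might fail: Needs StableKeplerCounting with UNIFORM C (else the far-field gain κf/(m−3) drowns in C/(m−3)); the trial-state boundary term C N^{(3−m)/3}/(m−3) forces N → ∞ before m ↓ 3 — the iterated order is essential and the only one claimed.
sources: Hales1998, Hales2012, KubinPonsiglione2021, BorodachovHardinSaff2019, BlancLewin2015
[crux] BARLOW LOCAL ORDER AT THE CORNER (card A1, finite-N form, no point processes): as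
CornerHcpOrder but with "g(barlowStacking 1 √(2/3) s) for some Hägg sequence s and isometry g" in
place of hcp — lim_{m↓3} limsup_N (fraction of particles whose R-neighbourhood is not δ-close to a
rigid image of SOME close-packed stacking) = 0. Proof plan (= CornerGlue): E(N)/N = −½∫₁^∞ r^(−m−1)
K̄(r) dr with K̄ the mean neighbour count; D_i(r) := K_max(r) − K_i(r) ≥ 0; StableKeplerCounting at
p = x_i summed over i and symmetrised gives D̄(r) ≥ (κ f_ε K_max(r) − C r²)/(1+κ); the hcp-ball
trial state and UNIFORM Kepler (K_max − K_hcp ≤ C r²) give ½∫ r^(−m−1) D̄ ≤ C/(m−2) + o_N(1); hence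
limsup_N f_ε ≤ Φ_ε(m) = O((m−3)^{1/(m−2)}/κ(ε)) → 0; particles with an ε-bad particle within R′ are
≤ K_max(R′)·(bad count); SoftFejesTothHales(R, δ) converts R′-interior ε-goodness into the Barlow
R-fragment matching. [deps: StableKeplerCounting] [difficulty: L] -/
@[route_item "route-AtomisticToContinuum-CornerKeplerStability"]
def CornerBarlowOrder : Prop :=
  ∀ R δ η : ℝ, 0 < R → 0 < δ → 0 < η → ∃ m₀ : ℝ, 3 < m₀ ∧ ∀ m : ℝ, 3 < m → m < m₀ → ∃ M₀ : ℝ, ∀ M : ℝ, M₀ ≤ M → ∀ x : (N : ℕ) → (Fin N → EuclideanSpace ℝ (Fin 3)), (∀ N, Literature.MathematicalPhysics.StatisticalMechanics.IsGroundState (fun r : ℝ => if r < 1 then M else -(r ^ (-m)) / m) (x N)) → ∀ᶠ N : ℕ in Filter.atTop, (Nat.card {i : Fin N // ¬ ∃ (s : ℤ → ℤ) (g : EuclideanSpace ℝ (Fin 3) ≃ᵢ EuclideanSpace ℝ (Fin 3)), Literature.MathematicalPhysics.StatisticalMechanics.IsHaggSeq s ∧ (∀ j : Fin N, dist (x N j)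 (x N i) ≤ R → ∃ z ∈ g '' Literature.MathematicalPhysics.StatisticalMechanics.barlowStacking 1 (Real.sqrt (2 / 3)) s, dist (x N j) z ≤ δ) ∧ (∀ z ∈ g '' Literature.MathematicalPhysics.StatisticalMechanics.barlowStacking 1 (Real.sqrt (2 / 3)) s, dist z (x N i) ≤ R → ∃ j : Fin N, dist (x N j) z ≤ δ)} : ℝ) ≤ η * N

/-- item stmt-AtomisticToContinuum-5716 · crux · rank 4 · closed · moot by None · by planner
why it might fail: Low risk: sign is Poisson–Bessel positivity for a CM tail and BST2022 Fig. 3 has ζ_hcp − ζ_fcc > 0 for all s > 3/2; fails only through tsum junk (layer sums need m > 2, fine) or if Bessel prefactors grew fast enough in k to eat the e^{−5.92k} margin.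
sources: BeterminSamajTravenec2022, BurrowsEtAl2020, KiharaKoba1952, PartayOrtnerCsanyi2017, BurrowsCooperSchwerdtfeger2021
[crux] THE CM TAIL SELECTS HCP UNIFORMLY DOWN TO THE EDGE (card A2): for every m ∈ (3, 4], with
J_k(m) := barlowCoupling (r ↦ −r⁻ᵐ/m) 1 √(2/3) k (aligned-minus-non-aligned interaction of a site
with the layer k levels away, ideal geometry): J₂(m) < 0, Σ k|J_k| < ∞ and J₂ + Σ_{k≥3}(k−1)|J_k| ≤
0 — exactly the hypotheses of HaggDominationAllRanges (stmt-0737), whence the alternating (hcp) word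
minimises the stacking energy window-wise. Proof plan: Poisson summation on the triangular layer
lattice; for the completely monotone φ(u) = u^(−m/2) the 2-D transform of x ↦ φ(|x|²+z²) is a
positive Gaussian/Bessel mixture, so J_k = −(1/A)Σ_{G≠0} φ̂_{kh}(G)(1 − cos 2πG·w) < 0 for all k ≥
1, m > 2, and |J_{k+1}/J_k| ≈ e^{−2π|G₁|h} = e^{−4π√2/3} ≈ 2.7×10⁻³ gives domination with four
orders of margin; alternatively certified interval numerics with a Bessel tail bound. [difficulty:
M] -/
@[route_item "route-AtomisticToContinuum-CornerKeplerStability"]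
def CornerStackingDomination : Prop :=
  ∀ m : ℝ, 3 < m → m ≤ 4 → Literature.MathematicalPhysics.StatisticalMechanics.barlowCoupling (fun r : ℝ => -(r ^ (-m)) / m) 1 (Real.sqrt (2 / 3)) 2 < 0 ∧ Summable (fun k : ℕ => (k : ℝ) * |Literature.MathematicalPhysics.StatisticalMechanics.barlowCoupling (fun r : ℝ => -(r ^ (-m)) / m) 1 (Real.sqrt (2 / 3)) k|) ∧ Literature.MathematicalPhysics.StatisticalMechanics.barlowCoupling (fun r : ℝ => -(r ^ (-m)) / m) 1 (Real.sqrt (2 / 3)) 2 + ∑' k : ℕ, (if 3 ≤ k then ((k : ℝ) - 1) * |Literature.MathematicalPhysics.StatisticalMechanics.barlowCoupling (fun r : ℝ => -(r ^ (-m)) / m) 1 (Real.sqrt (2 / 3)) k| else 0) ≤ 0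

/-- item stmt-AtomisticToContinuum-0737 · support · rank 9 · open · by planner
sources: PartayOrtnerCsanyi2017, BlancLewin2015
HÄGG DOMINATION, ALL RANGES, ARBITRARY (non-periodic) Hägg sequence, finite volume with O(1)
boundary term — the Mathlib-only core from which 0671 (typed: alternatingHagg minimises
haggStackingEnergy over all Hägg sequences under summable domination) follows by dividing by n and
taking liminf (haggStackingEnergy_alternating = tsum of even J_k is in HaggStacking.lean).
Statement: for J with Σ k|J_k| < ∞ and J_2 + Σ_{k≥3}(k−1)|J_k| ≤ 0, every ±1 sequence s and every n:
n·Σ_{k≥2 even} J_k ≤ H_n(J,s) + Σ_k k|J_k|, where H_n(J,s) = Σ_{m<n} Σ'_{k≥2} J_k·1[s_m+…+s_{m+k−1}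
≡ 0 mod 3] (= Literature.MathematicalPhysics.StatisticalMechanics.haggEnergy n J s definitionally).
Proof (Peierls count as in 0716, refuters g2-0/g2-1/g3-2): b := #{m<n : s(m+1) = s(m)}; k = 2
contributes exactly J_2(n − b); for k ≥ 3 a window m..m+k−1 with all internal bonds in [0,n) and
none bad is alternating, hence aligned iff k even; windows m<n containing a bad internal bond j<n
number ≤ (k−1)b, windows with an internal bond ≥ n number ≤ k−1; so |A_k − n[k even]| ≤ (k−1)(b+1)
and RHS − LHS ≥ b(−J_2 − Σ_{k≥3}(k−1)|J_k|) − Σ_{k≥3}(k−1)|J_k| ≥ −Σ_k k|J_k|. Extends 0716 (finite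
K, periodic s) to K = ∞ and aperiodic s; -/
@[route_item "route-AtomisticToContinuum-CornerKeplerStability"]
def HaggDominationAllRanges : Prop :=
  ∀ (J : ℕ → ℝ) (s : ℤ → ℤ) (n : ℕ), (∀ i, s i = 1 ∨ s i = -1) → Summable (fun k : ℕ => (k : ℝ) * |J k|) → J 2 + ∑' k : ℕ, (if 3 ≤ k then ((k : ℝ) - 1) * |J k| else 0) ≤ 0 → (n : ℝ) * ∑' k : ℕ, (if 2 ≤ k ∧ Even k then J k else 0) ≤ (∑ m ∈ Finset.range n, ∑' k : ℕ, (if 2 ≤ k ∧ (∑ i ∈ Finset.range k, s ((m : ℤ) + i)) % 3 = 0 then J k else 0)) + ∑' k : ℕ, (k : ℝ) * |J k|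

/-- item stmt-AtomisticToContinuum-5717 · support · rank 9 · closed · moot by None · by planner
sources: Hales2012, HalesDSP2012
[support] SOFT FEJES TÓTH–HALES BY COMPACTNESS (qualitative, rate-free; known modulo the tree's
named fact): FejesTothKissingTwelve → for all R, δ > 0 there are ε > 0, R′ such that for every
1-separated V ∋ p all of whose points within R′ of p have their punctured 1.255-neighbourhood
ε-ShellCloseTo the fcc or hcp pattern, V ∩ B̄(p,R) is two-way δ-matched with g(barlowStacking 1
√(2/3) s) for some Hägg s and isometry g. Proof: contradiction + local Hausdorff compactness of
1-separated sets; the limit set (scaled by 2) is a unit-ball packing with kissing number twelve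
(pattern shells exclude further centres below ≈1.41), so FejesTothKissingTwelve (+
HalesDSP_layerPackings_holds, in tree) makes it a Barlow stacking; rescale barlowStacking 2
(2√(2/3)) s = 2•barlowStacking 1 √(2/3) s. [difficulty: M] -/
@[route_item "route-AtomisticToContinuum-CornerKeplerStability"]
def SoftFejesTothHales : Prop :=
  Literature.Geometry.DiscreteGeometry.FejesTothKissingTwelve → ∀ R δ : ℝ, 0 < R → 0 < δ → ∃ ε R' : ℝ, 0 < ε ∧ ∀ V : Set (EuclideanSpace ℝ (Fin 3)), (∀ v ∈ V, ∀ w ∈ V, v ≠ w → 1 ≤ dist v w) → ∀ p ∈ V, (∀ v ∈ V, dist v p ≤ R' → ∃ T : Finset (EuclideanSpace ℝ (Fin 3)), (↑T : Set (EuclideanSpace ℝ (Fin 3))) = (fun w => w - v) '' {w | w ∈ V ∧ w ≠ v ∧ dist w v ≤ 1.255} ∧ (Literature.Geometry.DiscreteGeometry.ShellCloseTo ε T Literature.Geometry.DiscreteGeometry.fccKissingPattern ∨ Literature.Geometry.DiscreteGeometry.ShellCloseTo ε T Literature.Geometry.DiscreteGeometry.hcpKissingPattern)) → ∃ (s : ℤ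 → ℤ) (g : EuclideanSpace ℝ (Fin 3) ≃ᵢ EuclideanSpace ℝ (Fin 3)), Literature.MathematicalPhysics.StatisticalMechanics.IsHaggSeq s ∧ (∀ v ∈ V, dist v p ≤ R → ∃ z ∈ g '' Literature.MathematicalPhysics.StatisticalMechanics.barlowStacking 1 (Real.sqrt (2 / 3)) s, dist v z ≤ δ) ∧ (∀ z ∈ g '' Literature.MathematicalPhysics.StatisticalMechanics.barlowStacking 1 (Real.sqrt (2 / 3)) s, dist z p ≤ R → ∃ v ∈ V, dist v z ≤ δ)

/-- item stmt-AtomisticToContinuum-5718 · support · rank 9 · closed · moot by None · by planner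
sources: BlancLewin2015, KubinPonsiglione2021
[support] FINITE WALL = HARD CORE: for every m > 3 there is M₀ such that for all M ≥ M₀ and all N,
ground states of V_{M,m} exist and have all interparticle distances ≥ 1. Proof: E(N) ≤ E(N−1) − 1/m
(add a touching particle beyond the x-extreme one), so every site energy of a ground state is ≤ 0;
cubes of side ½ hold ≤ 1 + n* particles (n* = max number of sub-unit neighbours), so a particle with
n* close neighbours has site energy ≥ M n* − (1+n*)C_m, forcing n* = 0 once M > 2C_m (C_m = Σ_cubes
dist^(−m)/m < ∞ for m > 3); existence by lower semicontinuity of V (V(1) = −1/m ≤ M) + strict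
binding/translation compactness as in LennardJonesGroundStatesExist_holds. [difficulty: M] -/
@[route_item "route-AtomisticToContinuum-CornerKeplerStability"]
def FiniteWallHardCore : Prop :=
  ∀ m : ℝ, 3 < m → ∃ M₀ : ℝ, ∀ M : ℝ, M₀ ≤ M → ∀ N : ℕ, (∃ x : Fin N → EuclideanSpace ℝ (Fin 3), Literature.MathematicalPhysics.StatisticalMechanics.IsGroundState (fun r : ℝ => if r < 1 then M else -(r ^ (-m)) / m) x) ∧ ∀ x : Fin N → EuclideanSpace ℝ (Fin 3), Literature.MathematicalPhysics.StatisticalMechanics.IsGroundState (fun r : ℝ => if r < 1 then M else -(r ^ (-m)) / m) x → ∀ i j : Fin N, i ≠ j → 1 ≤ dist (x i) (x j)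

/-- item stmt-AtomisticToContinuum-5719 · support · rank 9 · closed · moot by None · by planner
sources: Hales1998, HalesDSP2012, HalesEtAl2015
[support] UNIFORM KEPLER COUNTING BOUND (known; Hales1998 Lemma 1.2 / HalesDSP2012 Lemma 6.13 + Thm
6.9 with the constant made uniform over packings, de-saturated): there is C with #(V ∩ B̄(p,r)) ≤
(4√2π/3) r³ + C r² for every 1-separated V, p, r ≥ 1. Implied by StableKeplerCounting
(uniformKepler_of_stable in the planner's Sketch); filed separately because the glue needs it at
every scale and LJ tail-accounting routes want it as is. [difficulty: L] -/
@[route_item "route-AtomisticToContinuum-CornerKeplerStability"]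
def UniformKeplerCounting : Prop :=
  ∃ C : ℝ, ∀ V : Set (EuclideanSpace ℝ (Fin 3)), (∀ v ∈ V, ∀ w ∈ V, v ≠ w → 1 ≤ dist v w) → ∀ (p : EuclideanSpace ℝ (Fin 3)) (r : ℝ), 1 ≤ r → (({v ∈ V | dist v p ≤ r}).ncard : ℝ) ≤ 4 * Real.sqrt 2 * Real.pi / 3 * r ^ 3 + C * r ^ 2

/-- item stmt-AtomisticToContinuum-5720 · support · rank 9 · closed · moot by None · by planner
sources: Hales1998, KubinPonsiglione2021, BlancLewin2015
[support] THE EDGE-OF-SUMMABILITY BOOKKEEPING (glue of the foreseen split of CornerBarlowOrder):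
StableKeplerCounting → (conclusion of SoftFejesTothHales) → (conclusion of FiniteWallHardCore) →
CornerBarlowOrder, by the by-parts identity, the deficit functional D̄, the hcp-ball trial state and
the R′-interior-good counting described under CornerBarlowOrder; constants m-uniform, limits in the
order N → ∞ then m ↓ 3. [difficulty: L] -/
@[route_item "route-AtomisticToContinuum-CornerKeplerStability"]
def CornerGlue : Prop :=
  StableKeplerCounting → (∀ R δ : ℝ, 0 < R → 0 < δ → ∃ ε R' : ℝ, 0 < ε ∧ ∀ V : Set (EuclideanSpace ℝ (Fin 3)), (∀ v ∈ V, ∀ w ∈ V, v ≠ w → 1 ≤ dist v w) → ∀ p ∈ V, (∀ v ∈ V, dist v p ≤ R' → ∃ T : Finset (EuclideanSpace ℝ (Fin 3)), (↑T : Set (EuclideanSpace ℝ (Fin 3))) = (fun w => w - v) '' {w | w ∈ V ∧ w ≠ v ∧ dist w v ≤ 1.255} ∧ (Literature.Geometry.DiscreteGeometry.ShellCloseTo ε T Literature.Geometry.DiscreteGeometry.fccKissingPattern ∨ Literature.Geometry.DiscreteGeometry.ShellCloseTo ε T Literature.Geometry.DiscreteGeometry.hcpKissingPattern)) → ∃ (s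 : ℤ → ℤ) (g : EuclideanSpace ℝ (Fin 3) ≃ᵢ EuclideanSpace ℝ (Fin 3)), Literature.MathematicalPhysics.StatisticalMechanics.IsHaggSeq s ∧ (∀ v ∈ V, dist v p ≤ R → ∃ z ∈ g '' Literature.MathematicalPhysics.StatisticalMechanics.barlowStacking 1 (Real.sqrt (2 / 3)) s, dist v z ≤ δ) ∧ (∀ z ∈ g '' Literature.MathematicalPhysics.StatisticalMechanics.barlowStacking 1 (Real.sqrt (2 / 3)) s, dist z p ≤ R → ∃ v ∈ V, dist v z ≤ δ)) → (∀ m : ℝ, 3 < m → ∃ M₀ : ℝ, ∀ M : ℝ, M₀ ≤ M → ∀ N : ℕ, (∃ x : Fin N → EuclideanSpace ℝ (Fin 3), Literature.MathematicalPhysics.StatisticalMechanics.IsGroundState (fun r : ℝ => if r < 1 then M else -(r ^ (-m)) / m) x) ∧ ∀ x : Fin N → EuclideanSpace ℝ (Fin 3), Literature.MathematicalPhysics.StatisticalMechanics.IsGroundState (fun r : ℝ => if r < 1 then M else -(r ^ (-m)) / m) x → ∀ i j : Fin N, i ≠ j → 1 ≤ dist (x i) (x j)) → CornerBarlowOrd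er

/-- item stmt-AtomisticToContinuum-5721 · support · rank 9 · closed · moot by None · by planner
sources: PartayOrtnerCsanyi2017, BeterminSamajTravenec2022, Hales2012
[support] STACKING FAULTS ARE UNFUNDED AT THE CORNER (glue): CornerBarlowOrder →
CornerStackingDomination → (stmt-0737) → CornerHcpOrder. In a configuration that is Barlow-ordered
off a fraction f → 0, the energy relative to the hcp trial splits into far field (≥ 0, Kepler),
defect near field (≤ G·f, G m-uniform), and layer-registry terms of the Barlow grains, which by
barlowSiteEnergy_eq / Hägg domination exceed the alternating word's by ≥ c_J·(fault density) −
O(grain-boundary density), c_J = |J₂| − Σ_{k≥3}(k−1)|J_k| > 0 m-uniform; a ground state has excess ≤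
o_N(1), so the fault density is ≤ (G f + o(1))/c_J → 0 and Barlow fragments upgrade to hcp fragments
(larger R′, same δ). [difficulty: L] -/
@[route_item "route-AtomisticToContinuum-CornerKeplerStability"]
def CornerFaultsGlue : Prop :=
  CornerBarlowOrder → CornerStackingDomination → (∀ (J : ℕ → ℝ) (s : ℤ → ℤ) (n : ℕ), (∀ i, s i = 1 ∨ s i = -1) → Summable (fun k : ℕ => (k : ℝ) * |J k|) → J 2 + ∑' k : ℕ, (if 3 ≤ k then ((k : ℝ) - 1) * |J k| else 0) ≤ 0 → (n : ℝ) * ∑' k : ℕ, (if 2 ≤ k ∧ Even k then J k else 0) ≤ (∑ m ∈ Finset.range n, ∑' k : ℕ, (if 2 ≤ k ∧ (∑ i ∈ Finset.range k, s ((m : ℤ) + i)) % 3 = 0 then J k else 0)) + ∑' k : ℕ, (k : ℝ) * |J k|) → CornerHcpOrder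

/-- item stmt-AtomisticToContinuum-5722 · assembly · rank 1 · closed · moot by None · by planner
sources: Hales1998, Hales2012, KubinPonsiglione2021
[assembly] StableKeplerCounting → SoftFejesTothHales → FiniteWallHardCore → CornerGlue →
CornerStackingDomination → HaggDominationAllRanges → CornerFaultsGlue → FejesTothKissingTwelve →
CornerHcpOrder. -/
@[route_item "route-AtomisticToContinuum-CornerKeplerStability"]
def Assembly : Prop :=
  StableKeplerCounting → SoftFejesTothHales → FiniteWallHardCore → CornerGlue → CornerStackingDomination → HaggDominationAllRanges → CornerFaultsGlue → Literature.Geometry.DiscreteGeometry.FejesTothKissingTwelve → CornerHcpOrder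

end Summit.AtomisticToContinuum.Crystallization.Theses.CornerKeplerStability
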